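import Summits.HubbardSuperconductivity.HubbardSuperconductivity.Theorems.BalabanIRBirComplexStableXYRStubThinFormCoercive
import Literature.MathematicalPhysics.QuantumFieldTheory.TorusChartFlatCochains
import HarnessLib

/-!
# Route `BalabanIR`, crux `BirComplexStableXYR` (item `stmt-HubbardSuperconductivity-14845`),
# line `fat-gaussian-defect-calculus`: stub B5 `stub_windingSectorCost`

Helper (`--supports`) for the crux
`Summit.HubbardSuperconductivity.HubbardSuperconductivity.Theses.BalabanIR.BirComplexStableXYR`,
line `fat-gaussian-defect-calculus` (lead skeleton `Cruxes/BirComplexStableXYR/Lines/fat_gaussian_defect_calculus.lean`),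
stub B5 `stub_windingSectorCost`: **the Gaussian cost of a pure holonomy sector is at most that of the constant
twist.**

**Statement.** On the space–time torus `Λ L M = (Fin 2 → ZMod L) × ZMod M` (chart `F = TorusChart.piProdZMod 2 L M`,
directions `0, 1` of period `L`, direction `2` of period `M`), for a window Fourier table `c : Table r` (`r ≥ 2`) with
(N) `Σ_n c_n = 0` and the coercivity (C), let `𝒬(ω) = Σ_s Q(P ω s)` be the thin form (window Hessian form `Q` of the
window path configurations `P ω s`, both given by their defining equations `hQ`, `hP`).  If `a` is a vortex-free
integer `1`-cochain (`d₁ a = 0`) with windings `wind a = h`, and `σ = 2πa − d₀ψ` is a strain in the gauge class of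
`2πa` satisfying Pythagoras `𝒬(d₀u − σ) = 𝒬(d₀u) + 𝒬(σ)` for all `u`, then
`𝒬(σ) ≤ |Λ L M| · Q(w ↦ 2π(h₀w₁/L + h₁w₂/L + h₂w₃/M))`.

**Proof.** The real cochain `2πa − κ`, `κ(x,i) = 2πh_i/N_i` the CONSTANT twist, is flat (`d₁ a = 0`, `κ` is
site-independent) and has zero winding (`wind (2πa) μ = 2πh_μ = N_μ · 2πh_μ/N_μ = wind κ μ`), hence is a real gradient
`d₀ g` (seat 1's `TorusChart.exists_d₀_eq_iff`).  With `u = g − ψ` one has `d₀u − σ = −κ`, so Pythagoras and the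
non-negativity of the thin form (landed coercivity `stub_thinFormCoercive`) give `𝒬(σ) ≤ 𝒬(−κ) = 𝒬(κ)` (`Q` is even),
and `P κ s = (w ↦ 2π(h₀w₁/L + h₁w₂/L + h₂w₃/M))` for every corner `s` (line sums of a site-independent cochain).
Elementary; no definition and no named fact is introduced; sorry-free. [folklore]
-/

set_option linter.dupNamespace false -- `Summit.<S>.<S>.Theorems…` repeats the summit name (D-0017 layout)

namespace Summit.HubbardSuperconductivity.HubbardSuperconductivity.Theorems.FSUnfolding

open scoped BigOperators
open Literature.MathematicalPhysics.QuantumFieldTheory Literature.Probability.LatticeModels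
open Summit.HubbardSuperconductivity.BirComplexStableXYNegative

/-- **Line sums of a site-independent real `1`-cochain**: `n` edges in direction `i`, each carrying `v i`, sum to
`n · v i`. [folklore] -/
theorem windingSector_lineSum_const {Λ : Type*} [AddCommGroup Λ] {d : ℕ} (F : TorusChart Λ d)
    (v : Fin d → ℝ) (i : Fin d) (n : ℕ) (y : Λ) :
    F.lineSum (fun (_ : Λ) j => v j) i n y = (n : ℝ) * v i := by
  simp only [TorusChart.lineSum, Finset.sum_const, Finset.card_range, nsmul_eq_mul]

/-- **The winding of a site-independent real `1`-cochain** in direction `μ` is `N_μ · v_μ`. [folklore] -/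
theorem windingSector_wind_const {Λ : Type*} [AddCommGroup Λ] {d : ℕ} (F : TorusChart Λ d)
    (v : Fin d → ℝ) (μ : Fin d) : F.wind (fun (_ : Λ) j => v j) μ = (F.period μ : ℝ) * v μ := by
  rw [TorusChart.wind_eq, windingSector_lineSum_const]

/-- **The winding of a real multiple of an integer `1`-cochain** is the same multiple of its integer winding.
[folklore] -/
theorem windingSector_wind_mul_intCast {Λ : Type*} [AddCommGroup Λ] {d : ℕ} (F : TorusChart Λ d)
    (t : ℝ) (a : Λ → Fin d → ℤ) (μ : Fin d) :
    F.wind (fun x i => t * (a x i : ℝ)) μ = t * ((F.wind a μ : ℤ) : ℝ) := by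
  simp only [TorusChart.wind_eq, TorusChart.lineSum, Int.cast_sum, Finset.mul_sum]

/-- **A real multiple of a vortex-free integer `1`-cochain minus a site-independent cochain is flat** (the curl is
`t` times the integer curl, and a site-independent cochain has no curl). [folklore] -/
theorem windingSector_isFlat {Λ : Type*} [AddCommGroup Λ] {d : ℕ} (F : TorusChart Λ d)
    (t : ℝ) (a : Λ → Fin d → ℤ) (ha : F.d₁ a = 0) (v : Fin d → ℝ) :
    F.IsFlat (fun x i => t * (a x i : ℝ) - v i) := by
  intro x i j
  have hz : F.d₁ a x i j = 0 := by rw [ha]; rfl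
  simp only [TorusChart.d₁_apply] at hz ⊢
  have hz' : ((a x i : ℤ) : ℝ) + (a (x + F.gen i) j : ℝ) - (a (x + F.gen j) i : ℝ) - (a x j : ℝ) = 0 := by
    exact_mod_cast hz
  linear_combination t * hz'

/-- **A vortex-free cochain is, over `ℝ`, its constant holonomy twist plus a gradient.**  For an integer `1`-cochain
`a` with `d₁ a = 0` on a charted torus and any real `t`, the real cochain `t·a − κ`, `κ(x,i) = t · wind a i / N_i`, is
flat with zero winding vector, hence a real gradient `d₀ g` (`TorusChart.exists_d₀_eq_iff`). [folklore] -/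
theorem windingSector_exists_d₀ {Λ : Type*} [AddCommGroup Λ] {d : ℕ} (F : TorusChart Λ d)
    (t : ℝ) (a : Λ → Fin d → ℤ) (ha : F.d₁ a = 0) :
    ∃ g : Λ → ℝ, (fun x i => t * (a x i : ℝ) - t * ((F.wind a i : ℤ) : ℝ) / (F.period i : ℝ)) = F.d₀ g := by
  refine (F.exists_d₀_eq_iff _).2
    ⟨windingSector_isFlat F t a ha (fun i => t * ((F.wind a i : ℤ) : ℝ) / (F.period i : ℝ)), ?_⟩
  funext μ
  have hsub : (fun x i => t * (a x i : ℝ) - t * ((F.wind a i : ℤ) : ℝ) / (F.period i : ℝ)) =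
      (fun x i => t * (a x i : ℝ)) - (fun (_ : Λ) i => t * ((F.wind a i : ℤ) : ℝ) / (F.period i : ℝ)) := rfl
  have hne : (F.period μ : ℝ) ≠ 0 := (Nat.cast_pos.2 (F.period_pos μ)).ne'
  rw [hsub, TorusChart.wind_sub, Pi.sub_apply, windingSector_wind_mul_intCast, windingSector_wind_const,
    Pi.zero_apply, mul_div_assoc', mul_div_cancel_left₀ _ hne, sub_self]

/-- **Stub B5 `stub_windingSectorCost` (registered signature, verbatim): the Gaussian cost of a pure holonomy sector is
only that of the constant twist.**  For a vortex-free integer `1`-cochain `a` (`d₁a = 0`) with windings `h = wind a`,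
ANY strain `σ = 2πa − d₀ψ` satisfying the Pythagoras/normal-equation property of `stub_fsRepresentation` has thin-form
energy at most that of the constant cochain `2πh_μ/N_μ`: `𝒬(σ) ≤ |Λ| · Q(w ↦ 2π(h₀w₁/L + h₁w₂/L + h₂w₃/M))`.
(`2πa = κ + d₀g` over `ℝ` by `windingSector_exists_d₀`; Pythagoras at `u = g − ψ` gives `𝒬(−κ) = 𝒬(d₀u) + 𝒬(σ) ≥ 𝒬(σ)`
by the coercivity `stub_thinFormCoercive`; `Q` is even and `P κ s` is the displayed window configuration for every
corner `s`.)  In particular a temporal holonomy `h₂` costs only `O(K·h₂²·L²/M)` in the exponent. [folklore] -/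
theorem stub_windingSectorCost :
    ∀ (r : ℕ) (c : Table r) (c₀ : ℝ), 2 ≤ r → 0 < c₀ → c.sum (fun _ a => a) = 0 →
      (∀ φ : W r → ℝ, c₀ * ∑ w, ∑ w', (1 - Real.cos (φ w - φ w')) ≤ (genF c φ).re) →
      ∀ (L M : ℕ) [NeZero L] [NeZero M]
      (P : (Λ L M → Fin 3 → ℝ) → Λ L M → W r → ℝ),
      (∀ (ω : Λ L M → Fin 3 → ℝ) (s : Λ L M) (w : W r), P ω s w =
        (TorusChart.piProdZMod 2 L M).lineSum ω 0 (w.1 : ℕ) s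
          + (TorusChart.piProdZMod 2 L M).lineSum ω 1 (w.2.1 : ℕ) (s + (w.1 : ℕ) • (TorusChart.piProdZMod 2 L M).gen 0)
          + (TorusChart.piProdZMod 2 L M).lineSum ω 2 (w.2.2 : ℕ)
            (s + (w.1 : ℕ) • (TorusChart.piProdZMod 2 L M).gen 0 + (w.2.1 : ℕ) • (TorusChart.piProdZMod 2 L M).gen 1)) →
      ∀ (Q : (W r → ℝ) → ℝ),
      (∀ u : W r → ℝ, Q u = (-c.sum (fun n a => a * (((∑ w, (n w : ℝ) * u w) ^ 2 : ℝ) : ℂ))).re) →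
      ∀ (h : Fin 3 → ℤ) (a : Λ L M → Fin 3 → ℤ), (TorusChart.piProdZMod 2 L M).d₁ a = 0 →
        (TorusChart.piProdZMod 2 L M).wind a = h →
      ∀ (σ : Λ L M → Fin 3 → ℝ),
        (∃ ψ : Λ L M → ℝ, σ = fun x i => 2 * Real.pi * (a x i : ℝ) - (TorusChart.piProdZMod 2 L M).d₀ ψ x i) →
        (∀ u : Λ L M → ℝ,
          ∑ s : Λ L M, Q (P (fun x i => (TorusChart.piProdZMod 2 L M).d₀ u x i - σ x i) s) =
            ∑ s : Λ L M, Q (P ((TorusChart.piProdZMod 2 L M).d₀ u) s) + ∑ s : Λ L M, Q (P σ s)) →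
        ∑ s : Λ L M, Q (P σ s) ≤
          (Fintype.card (Λ L M) : ℝ) * Q (fun w : W r => 2 * Real.pi *
            ((h 0 : ℝ) * ((w.1 : ℕ) : ℝ) / L + (h 1 : ℝ) * ((w.2.1 : ℕ) : ℝ) / L + (h 2 : ℝ) * ((w.2.2 : ℕ) : ℝ) / M)) := by
  intro r c c₀ hr hc₀ hN hC L M _ _ P hP Q hQ h a hd₁ hwind σ hσ hpyth
  obtain ⟨ψ, hσ⟩ := hσ
  set F := TorusChart.piProdZMod 2 L M with hF
  -- the periods of the space–time chart (`0, 1 ↦ L`, `2 ↦ M`)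
  have hper0 : F.period 0 = L := TorusChart.piProdZMod_period_castSucc 2 L M 0
  have hper1 : F.period 1 = L := TorusChart.piProdZMod_period_castSucc 2 L M 1
  have hper2 : F.period 2 = M := TorusChart.piProdZMod_period_last 2 L M
  -- (1) the thin form is non-negative on every real `1`-cochain (coercivity, P1e)
  have hpsd : ∀ ω : Λ L M → Fin 3 → ℝ, 0 ≤ ∑ s, Q (P ω s) := by
    intro ω
    have h1 := stub_thinFormCoercive r c c₀ hr hc₀ hN hC L M ω
    have h2 : 0 ≤ 2 * c₀ * ∑ x : Λ L M, ∑ i : Fin 3, (ω x i) ^ 2 :=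
      mul_nonneg (mul_nonneg zero_le_two hc₀.le)
        (Finset.sum_nonneg fun x _ => Finset.sum_nonneg fun i _ => sq_nonneg _)
    have h3 : 2 * c₀ * ∑ x : Λ L M, ∑ i : Fin 3, (ω x i) ^ 2 ≤ ∑ s, Q (P ω s) := by
      simp only [hQ, hP]
      exact h1
    exact h2.trans h3
  -- (2) `2πa = κ + d₀ g` over `ℝ`, `κ (x, i) = 2π h i / N_i` the constant twist
  obtain ⟨g, hg⟩ := windingSector_exists_d₀ F (2 * Real.pi) a hd₁
  rw [hwind] at hg
  -- (3) Pythagoras at `u = g - ψ`: `d₀ u - σ = -κ`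
  have hkey : (fun x i => F.d₀ (fun y => g y - ψ y) x i - σ x i) =
      fun x i => -(2 * Real.pi * ((h i : ℤ) : ℝ) / (F.period i : ℝ)) := by
    funext x i
    have hgx := congrFun (congrFun hg x) i
    rw [hσ]
    simp only [TorusChart.d₀_apply] at hgx ⊢
    linarith
  have hP' := hpyth (fun y => g y - ψ y)
  rw [hkey] at hP'
  have hle : ∑ s, Q (P σ s) ≤ ∑ s, Q (P (fun x i => -(2 * Real.pi * ((h i : ℤ) : ℝ) / (F.period i : ℝ))) s) := by
    have h0 := hpsd (F.d₀ fun y => g y - ψ y)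
    linarith
  -- (4) the window configuration of the constant twist, and evenness of `Q`
  have hPκ : ∀ (s : Λ L M), P (fun x i => -(2 * Real.pi * ((h i : ℤ) : ℝ) / (F.period i : ℝ))) s =
      fun w : W r => -(2 * Real.pi *
        ((h 0 : ℝ) * ((w.1 : ℕ) : ℝ) / L + (h 1 : ℝ) * ((w.2.1 : ℕ) : ℝ) / L + (h 2 : ℝ) * ((w.2.2 : ℕ) : ℝ) / M)) := by
    intro s
    funext w
    rw [hP]
    simp only [TorusChart.lineSum, Finset.sum_const, Finset.card_range, nsmul_eq_mul, hper0, hper1, hper2]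
    ring
  have hQeven : ∀ u : W r → ℝ, Q (fun w => -u w) = Q u := by
    intro u
    simp only [hQ, mul_neg, Finset.sum_neg_distrib, neg_sq]
  have hconst : ∀ s : Λ L M, Q (P (fun x i => -(2 * Real.pi * ((h i : ℤ) : ℝ) / (F.period i : ℝ))) s) =
      Q (fun w : W r => 2 * Real.pi *
        ((h 0 : ℝ) * ((w.1 : ℕ) : ℝ) / L + (h 1 : ℝ) * ((w.2.1 : ℕ) : ℝ) / L + (h 2 : ℝ) * ((w.2.2 : ℕ) : ℝ) / M)) := by
    intro s
    rw [hPκ s]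
    exact hQeven _
  -- (5) assemble
  calc ∑ s, Q (P σ s)
      ≤ ∑ s, Q (P (fun x i => -(2 * Real.pi * ((h i : ℤ) : ℝ) / (F.period i : ℝ))) s) := hle
    _ = _ := by simp only [hconst, Finset.sum_const, Finset.card_univ, nsmul_eq_mul]

end Summit.HubbardSuperconductivity.HubbardSuperconductivity.Theorems.FSUnfolding
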